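import Summits.ABC.IUTFork.Joshi.TestThetaValuesLocusDictionaryGenuine
import HarnessLib

/-!
# R-J census row Y-08 (sequel) — the volume dictionary at a LONE odd unramified bad prime of the genuine setting, WITHOUT the root tower:
# print's `htq` still refutes it (canonical point alone); Joshi's `htqJ` reduces it to a value-match of size `< 1`

Proof-only sequel (abc-iut cell, branch E → R-J census, rung LADDER-ABC:A2.E / A2.RESCUE.J; seat abc-iut-E-t3, gen 7) of
`Joshi/TestThetaValuesLocusDictionaryGenuine.lean` (root-tower data: `VolumeDictionary` KERNEL-FALSE at every non-wild place for every q-idele).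
**No side is taken** on [IUTchIII] Cor. 3.12, on Joshi's claims (unrefereed arXiv preprints) or on Mochizuki's report; typed ≠ proved ≠ endorsed;
instantiated ≠ endorsed. PROOF-ONLY (0 definitions, no `Prop` fact, no `sorry`); `S := Cor312Vol.PilotKummerIndRelated` does not occur.

HERE the prototype datum carries only the CANONICAL POINT of the proof of [J-IIp] Thm. 9.2.1 (no root tower), and the prime `p` (odd, `p ∤ disc(F)`,
carrying a bad place) has ONE place of `F` above it, so there is NO hull gain (abc-iut-c312-5
`thetaLocal_settingPrVolSharp_eq_logvol_thetaRegion3_of_subsingleton`): `logvol(ⁿ˒°𝒰_{j,p}) = j²·A_p` with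
`A_p := (1/[F:ℚ])·Σ_{v|p}(−P_q(v))·log N(v) < 0` (abc-iut-E-t44's `logvol_thetaRegion3_settingPrVolSharp_inr`, abc-iut-E-t4's `qSum_neg`).
* **`not_volumeDictionary_settingPrVolSharp_htq_of_subsingleton`** — under print's `htq` (c312-7: `t_q` realises `P_q`, `qLocal = A_p`):
  `Σ_j hull = (Σ_j j²)·A_p < ℓ⋆·A_p = Σ_j qLocal`, i.e. the `p`-summand of the typed inequality FAILS (Dupuy–Hilado's constant
  `(ℓ⋆+1)(2ℓ⋆+1)/6 > 1`, c312-7's `not_volumeTransport` number), so NO prototype datum with a canonical point has a volume dictionary — tower or not.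
* **`volumeDictionary_settingPrVolSharp_htqJ_iff_of_subsingleton`** — under Joshi's `htqJ` ([J-III] (9.9.4): `t_q` realises `ℓ⋆²·P_q = P_{Θ,ℓ⋆}`,
  `qLocal = ℓ⋆²·A_p`): `VolumeDictionary ⟺ ℓ⋆ = ℓ⋆_J ∧ log|ξ|_0 = ℓ⋆²·A_p ∧ |Θ̃|_B = exp((Σ_j j²)·A_p)`, `Σ_j j² = ℓ⋆(ℓ⋆+1)(2ℓ⋆+1)/6` — a size
  `< 1`, exactly the tower-free profile `|ξ|_0^{(Σ_j j²)/ℓ⋆²}` of a lone canonical point; excluded by every root tower (parent file), compatible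
  with Thm. 9.2.1 (`ℓ⋆³ ≥ Σ_j j²`). LOCATED, not adjudicated: whether a tower-free prototype datum is a faithful [J-IIp] object (`F = ℂ_p^♭` is
  algebraically closed, §2.1 p. 7 l. 12) is for the referee lanes.
[claim: Joshi2023ATS2Local, status: disputed] [claim: Joshi2024ATS3, status: disputed] [claim: Mochizuki2012, status: disputed]
[cite: DupuyHilado2025, Def. 3.1.1, §3.3, §3.6, §3.9, Thm. 3.10.1] [cite: ScholzeStix2018, §2.2 pp. 9–10]. Standard axioms only.
-/

noncomputable section

open Set Function NumberField IsDedekindDomain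

namespace Summit.ABC.IUTFork.Joshi

open Thm311 Thm311.Real Cor312 Cor312Vol Literature.IUT.LogThetaLattice Literature.IUT.LogVolume Literature.IUT.HodgeTheaters

section GenuineLone

variable {F : Type} [Field F] [NumberField F] (X : PilotData F) {logv : PadicLogs F} (hlog : LogvAnalytic logv)
  (M : Type) [Field M] [NumberField M]
  (archPk : ∀ (j : (thetaIndex X).Label) (vQ : (thetaIndex X).VQ), Set ((logShellsDH X logv).Packet j vQ))
  (archSub : ∀ (j : (thetaIndex X).Label) (v : (thetaIndex X).V),
    Set ((logShellsDH X logv).Packet j ((thetaIndex X).over v)))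
  (Ψ : ℤ → ∀ v : (thetaIndex X).V, v ∈ (thetaIndex X).Vbad → Set ((logShellsDH X logv).StarPacket v))
  (act : ℤ → ∀ v : (thetaIndex X).V, v ∈ (thetaIndex X).Vbad →
    (logShellsDH X logv).StarPacket v → Module.End ℚ ((logShellsDH X logv).StarPacket v))
  (Mmod : ℤ → ∀ j : (thetaIndex X).LabelStar, Set ((logShellsDH X logv).GlobalPacket j.1))
  (region : ℤ → ∀ j : (thetaIndex X).LabelStar, FinDivisor M → ∀ vQ : (thetaIndex X).VQ,
    Set ((logShellsDH X logv).Packet j.1 vQ))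
  (n : ℤ) {HT : Type} {LogLink : HT → HT → Type} {IsFull : ∀ {s t : HT}, LogLink s t → Prop}
  (lat : LGPGaussianLogThetaLattice LogLink IsFull)
  {Frd : Type} {IsoF : Frd → Frd → Type} {Ob : Frd → Type} {realify : Frd → Frd} {Strip : Type}
  {IsoS : Strip → Strip → Type} {Mv : ∀ v : (thetaIndex X).V, v ∈ (thetaIndex X).Vbad → Type}
  [∀ v h, Monoid (Mv v h)]
  (sig : GlobalLGPFrobenioidSignature (thetaIndex X).lstar (thetaIndex X).V (· ∈ (thetaIndex X).Vbad)
    Frd IsoF Ob realify Strip IsoS Mv)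
  (split : SplittingMonoids Mv) {ObΔ : Type} {N : ∀ v : (thetaIndex X).V, v ∈ (thetaIndex X).Vbad → Type}
  [∀ v h, Monoid (N v h)] (qData : QPilotData ObΔ N)
  (t : ∀ (pp : Nat.Primes) (_ : Fin X.lstar) (x : (thetaIndex X).Fibre (.inr pp)),
    haveI : Fact (pp : ℕ).Prime := ⟨pp.2⟩; kOf X pp.1 x)
  (tq : ∀ (pp : Nat.Primes) (x : (thetaIndex X).Fibre (.inr pp)), haveI : Fact (pp : ℕ).Prime := ⟨pp.2⟩; kOf X pp.1 x)
  (htq0 : ∀ pp x, tq pp x ≠ 0)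
  (htq1 : ∀ (pp : Nat.Primes) (x : (thetaIndex X).Fibre (.inr pp)),
    haveI : Fact (pp : ℕ).Prime := ⟨pp.2⟩; placeOf X pp.1 x ∉ X.S → ‖tq pp x‖ = 1)
  {Fp Bp E0p : Type} [Field Fp] [CommRing Bp] [Field E0p] {Yp : Type} {Kp : Yp → Type} [∀ y, Field (Kp y)] {Gp : Type}

variable (ht0 : ∀ pp i x, t pp i x ≠ 0)
  (ht : ∀ (pp : Nat.Primes) (i : Fin X.lstar) (x : (thetaIndex X).Fibre (.inr pp)),
    haveI : Fact (pp : ℕ).Prime := ⟨pp.2⟩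
    Real.log ‖t pp i x‖ = -(X.thetaPilot i (placeOf X pp.1 x)) * logNorm F (placeOf X pp.1 x) /
      localDegree F (placeOf X pp.1 x))


/-- `Σ_{j=1}^{ℓ⋆} j² = ℓ⋆(ℓ⋆+1)(2ℓ⋆+1)/6` over `ℝ` (this seat's `PrototypeDatum.six_mul_sum_sq`). [folklore] -/
theorem sum_sq_labels_eq :
    ∑ i : Fin (thetaIndex X).lstar, ((((i : ℕ) + 1 : ℕ) : ℝ) ^ 2) =
      ((thetaIndex X).lstar : ℝ) * ((thetaIndex X).lstar + 1) * (2 * (thetaIndex X).lstar + 1) / 6 := by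
  have h := PrototypeDatum.six_mul_sum_sq (thetaIndex X).lstar
  have h' : (6 : ℝ) * ∑ i : Fin (thetaIndex X).lstar, ((((i : ℕ) + 1 : ℕ) : ℝ) ^ 2) =
      ((thetaIndex X).lstar : ℝ) * ((thetaIndex X).lstar + 1) * (2 * (thetaIndex X).lstar + 1) := by
    exact_mod_cast h
  linarith

include ht0 ht in
/-- At an odd unramified prime with ONE place of `F` above it, the hull log-volume at label `i+1` IS the (Ind3)-region's own, `(i+1)²·A_p`
(c312-5 `thetaLocal_settingPrVolSharp_eq_logvol_thetaRegion3_of_subsingleton` — no hull gain — with abc-iut-E-t44's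
`logvol_thetaRegion3_settingPrVolSharp_inr`), for every q-idele. [cite: DupuyHilado2025, §3.3, §3.6, §3.9] [claim: Mochizuki2012, status: disputed] -/
theorem logvol_thetaHull_settingPrVolSharp_of_subsingleton (i : Fin (thetaIndex X).lstar) (pp : Nat.Primes) (hp2 : 2 < (pp : ℕ))
    (hdisc : ¬ ((pp : ℕ) : ℤ) ∣ NumberField.discr F) [Subsingleton ((thetaIndex X).Fibre (.inr pp))] :
    haveI : Fact (pp : ℕ).Prime := ⟨pp.2⟩
    ((situationPrVol X hlog M archPk archSub Ψ act Mmod region).D n).logvol (Setting.labelSucc i) (.inr pp)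
        ((settingPrVolSharp X hlog M archPk archSub Ψ act Mmod region n lat sig split qData tq t htq0 htq1).thetaHull
          (Setting.labelSucc i) (.inr pp)) =
      (((i : ℕ) + 1 : ℕ) : ℝ) ^ 2 * ((∑ v ∈ placesOver F pp, -(X.qPilot v) * logNorm F v) / Module.finrank ℚ F) := by
  haveI : Fact (pp : ℕ).Prime := ⟨pp.2⟩
  have hHD := hullDefined_settingPrVolSharp_of_not_dvd X hlog M archPk archSub Ψ act Mmod region n t tq lat sig split qData ht0
    htq0 htq1 i pp hdisc
  have h := thetaLocal_settingPrVolSharp_eq_logvol_thetaRegion3_of_subsingleton X hlog M archPk archSub Ψ act Mmod region n t tq lat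
    sig split qData ht0 htq0 htq1 i pp hp2 hdisc
  unfold Setting.thetaLocal at h
  rw [if_pos hHD, WithTop.coe_eq_coe] at h
  exact h.trans (logvol_thetaRegion3_settingPrVolSharp_inr X hlog M archPk archSub Ψ act Mmod region n lat sig split qData t tq ht0 ht
    htq0 htq1 i pp)

include ht0 ht in
/-- **Under print's `htq` (c312-7: `t_q` realises `P_q`), at an odd unramified prime carrying a bad place with ONE place of `F` above it, NO
prototype datum with a canonical point has a volume dictionary — root tower or not**: `Σ_j hull = (Σ_j j²)·A_p < ℓ⋆·A_p = Σ_j qLocal` since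
`A_p < 0` (abc-iut-E-t4's `qSum_neg`) and `j² ≥ 1` with `4 > 1` at `j = 2 ≤ ℓ⋆`; i.e. the `p`-summand of the typed inequality FAILS there
(c312-7's `not_volumeTransport` number; Dupuy–Hilado's constant `(ℓ⋆+1)(2ℓ⋆+1)/6 > 1`). [claim: Joshi2023ATS2Local, status: disputed]
[claim: Mochizuki2012, status: disputed] [cite: DupuyHilado2025, Def. 3.1.1, §3.3, Thm. 3.10.1] -/
theorem not_volumeDictionary_settingPrVolSharp_htq_of_subsingleton
    (htq : ∀ (pp : Nat.Primes) (x : (thetaIndex X).Fibre (.inr pp)),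
      haveI : Fact (pp : ℕ).Prime := ⟨pp.2⟩
      Real.log ‖tq pp x‖ = -(X.qPilot (placeOf X pp.1 x)) * logNorm F (placeOf X pp.1 x) /
        localDegree F (placeOf X pp.1 x))
    (J : PrototypeDatum Fp Bp E0p Yp Kp Gp) (c : J.CanonicalPoint) (pp : Nat.Primes) (hp2 : 2 < (pp : ℕ))
    (hdisc : ¬ ((pp : ℕ) : ℤ) ∣ NumberField.discr F) [Subsingleton ((thetaIndex X).Fibre (.inr pp))]
    {v₀ : HeightOneSpectrum (𝓞 F)} (hv₀ : v₀ ∈ X.S) (hres : residueChar F v₀ = pp) :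
    ¬ VolumeDictionary J (settingPrVolSharp X hlog M archPk archSub Ψ act Mmod region n lat sig split qData tq t htq0 htq1)
      (.inr pp) := by
  haveI : Fact (pp : ℕ).Prime := ⟨pp.2⟩
  refine not_volumeDictionary_of_hullSum_lt_qSum c ?_
  change ∑ i : Fin (thetaIndex X).lstar,
      ((situationPrVol X hlog M archPk archSub Ψ act Mmod region).D n).logvol (Setting.labelSucc i) (.inr pp)
        ((settingPrVolSharp X hlog M archPk archSub Ψ act Mmod region n lat sig split qData tq t htq0 htq1).thetaHull
          (Setting.labelSucc i) (.inr pp)) < _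
  have hA := qSum_neg X hv₀ pp ((mem_placesOver_iff_residueChar v₀).2 hres)
  have hq : ∀ i : Fin (thetaIndex X).lstar,
      (settingPrVolSharp X hlog M archPk archSub Ψ act Mmod region n lat sig split qData tq t htq0 htq1).qLocal (Setting.labelSucc i)
        (.inr pp) = (∑ v ∈ placesOver F pp, -(X.qPilot v) * logNorm F v) / Module.finrank ℚ F := fun i =>
    qLocal_settingPrVolSharp_inr_of_realising X hlog M archPk archSub Ψ act Mmod region n lat sig split qData t tq htq0 htq1
      (fun v => -(X.qPilot v)) htq _ pp
  simp_rw [hq, logvol_thetaHull_settingPrVolSharp_of_subsingleton X hlog M archPk archSub Ψ act Mmod region n lat sig split qData t tq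
    htq0 htq1 ht0 ht _ pp hp2 hdisc]
  refine Finset.sum_lt_sum (fun i _ => ?_) ⟨⟨1, X.two_le_lstar⟩, Finset.mem_univ _, ?_⟩
  · have h1 : (1 : ℝ) ≤ (((i : ℕ) + 1 : ℕ) : ℝ) ^ 2 := by
      have : (1 : ℝ) ≤ (((i : ℕ) + 1 : ℕ) : ℝ) := by exact_mod_cast Nat.succ_le_succ (Nat.zero_le _)
      nlinarith
    nlinarith
  · have h4 : (((((⟨1, X.two_le_lstar⟩ : Fin (thetaIndex X).lstar) : ℕ) + 1 : ℕ) : ℝ)) ^ 2 = 4 := by norm_num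
    rw [h4]
    nlinarith

include ht0 ht in
/-- **Under Joshi's `htqJ` ([J-III] (9.9.4): `t_q` realises `ℓ⋆²·P_q = P_{Θ,ℓ⋆}`), at an odd unramified prime with ONE place of `F` above it,
the volume dictionary REDUCES to a value-match**: `VolumeDictionary J P p ⟺ ℓ⋆ = ℓ⋆_J ∧ log|ξ|_0 = ℓ⋆²·A_p ∧ |Θ̃|_B = exp((Σ_j j²)·A_p)`
(`Σ_j j² = ℓ⋆(ℓ⋆+1)(2ℓ⋆+1)/6`). The demanded size is `< 1` at a prime carrying a bad place (`A_p < 0`) — exactly the tower-free profile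
`|ξ|_0^{(Σ_j j²)/ℓ⋆²}` of a lone canonical point, excluded by every root tower (parent file), compatible with Thm. 9.2.1 (`ℓ⋆³ ≥ Σ_j j²`).
LOCATED, not adjudicated. [claim: Joshi2023ATS2Local, status: disputed] [claim: Joshi2024ATS3, status: disputed]
[cite: DupuyHilado2025, §3.3, Thm. 3.10.1] -/
theorem volumeDictionary_settingPrVolSharp_htqJ_iff_of_subsingleton
    (htqJ : ∀ (pp : Nat.Primes) (x : (thetaIndex X).Fibre (.inr pp)),
      haveI : Fact (pp : ℕ).Prime := ⟨pp.2⟩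
      Real.log ‖tq pp x‖ = -(((X.lstar : ℝ) ^ 2) * X.qPilot (placeOf X pp.1 x)) * logNorm F (placeOf X pp.1 x) /
        localDegree F (placeOf X pp.1 x))
    (J : PrototypeDatum Fp Bp E0p Yp Kp Gp) (pp : Nat.Primes) (hp2 : 2 < (pp : ℕ))
    (hdisc : ¬ ((pp : ℕ) : ℤ) ∣ NumberField.discr F) [Subsingleton ((thetaIndex X).Fibre (.inr pp))] :
    haveI : Fact (pp : ℕ).Prime := ⟨pp.2⟩
    VolumeDictionary J (settingPrVolSharp X hlog M archPk archSub Ψ act Mmod region n lat sig split qData tq t htq0 htq1) (.inr pp) ↔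
      (thetaIndex X).lstar = J.lstar ∧
        Real.log (J.abs0 J.xi) = ((X.lstar : ℝ) ^ 2) * ((∑ v ∈ placesOver F pp, -(X.qPilot v) * logNorm F v) / Module.finrank ℚ F) ∧
        J.size J.thetaLocus =
          ((Real.exp ((((thetaIndex X).lstar : ℝ) * ((thetaIndex X).lstar + 1) * (2 * (thetaIndex X).lstar + 1) / 6) *
            ((∑ v ∈ placesOver F pp, -(X.qPilot v) * logNorm F v) / Module.finrank ℚ F)) : ℝ) : EReal) := by
  haveI : Fact (pp : ℕ).Prime := ⟨pp.2⟩
  have hq : ∀ j : (thetaIndex X).Label,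
      (settingPrVolSharp X hlog M archPk archSub Ψ act Mmod region n lat sig split qData tq t htq0 htq1).qLocal j (.inr pp) =
        ((X.lstar : ℝ) ^ 2) * ((∑ v ∈ placesOver F pp, -(X.qPilot v) * logNorm F v) / Module.finrank ℚ F) := by
    intro j
    rw [qLocal_settingPrVolSharp_inr_of_realising X hlog M archPk archSub Ψ act Mmod region n lat sig split qData t tq htq0 htq1
      (fun v => -(((X.lstar : ℝ) ^ 2) * X.qPilot v)) htqJ j pp, mul_div_assoc', Finset.mul_sum]
    congr 1
    refine Finset.sum_congr rfl fun v _ => ?_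
    ring
  have hhull : ∑ i : Fin (thetaIndex X).lstar,
      ((situationPrVol X hlog M archPk archSub Ψ act Mmod region).D n).logvol (Setting.labelSucc i) (.inr pp)
        ((settingPrVolSharp X hlog M archPk archSub Ψ act Mmod region n lat sig split qData tq t htq0 htq1).thetaHull
          (Setting.labelSucc i) (.inr pp)) =
      (((thetaIndex X).lstar : ℝ) * ((thetaIndex X).lstar + 1) * (2 * (thetaIndex X).lstar + 1) / 6) *
        ((∑ v ∈ placesOver F pp, -(X.qPilot v) * logNorm F v) / Module.finrank ℚ F) := by
    simp_rw [logvol_thetaHull_settingPrVolSharp_of_subsingleton X hlog M archPk archSub Ψ act Mmod region n lat sig split qData t tq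
      htq0 htq1 ht0 ht _ pp hp2 hdisc]
    rw [← Finset.sum_mul, sum_sq_labels_eq X]
  have hexp := congrArg (fun r : ℝ => ((Real.exp r : ℝ) : EReal)) hhull
  constructor
  · intro D
    refine ⟨D.lstar_eq, ?_, ?_⟩
    · rw [← D.qLocal_eq ⟨0, thetaIndex_lstar_pos X⟩, hq]
    · rw [D.size_eq]
      exact hexp
  · rintro ⟨hl, hxi, hsize⟩
    exact
      { lstar_eq := hl
        qLocal_eq := fun i => by rw [hq, hxi]
        size_eq := by rw [hsize]; exact hexp.symm }

end GenuineLone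

end Summit.ABC.IUTFork.Joshi

end
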